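import Summits.BirchSwinnertonDyer.BirchSwinnertonDyer.Theorems.PrintCf2SplitBadTwoCMScalarAtV
import HarnessLib

/-!
# Crux `PrintCf2.SplitBadTwoRankOneOfFacts` (stmt-BirchSwinnertonDyer-20368), road α v10.3, S3c input (F3)/(PIN): THE CM SCALAR AT `v`
# IN POINT CURRENCY — on `E(K_v) = ((W.baseChange K).baseChange K_v).toAffine.Point` the descended isogeny acts as `1 − r` modulo
# `2^k E(K_v) + torsion`, for EVERY integer `N ≡ 1 − r (mod 2^k)`

Cell `bsd-print-cf2`, EXTRA WIDTH seat `bsd-line-cf2-p1-w3` g10 (prover-bsd-line-cf2-p1-w3-g10-0); `--supports stmt-BirchSwinnertonDyer-20368`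
(helper, Theses-free). HONEST FRAMING: nothing here closes the crux or a registered stub; BSD is not proved by any of this; no summit statement
is proved by this seat. No definition, no named fact, no `sorry`, no kit. beyond-print theorem: no.

WHY. File 1 (`…CMScalarAtV`, `CMPrimes.cmScalar_localPoints_of_frame` / `hPts_holds`) decides the CM scalar at the pinned place `v` in the
currency of the `Γ_{K_v}`-fixed points of `E(K̄_v)` (-w8 g2's (H1-pts)). The PLAIN road to (F3) (-w8 g3: `hcounts ⟸ (PI) ∧ (PIN) ∧ (ShaFin)`,
STATUS 2026-08-28T23:47:10Z) counts POINTS of `E(K_v) := ((W.baseChange K).baseChange (v.adicCompletion K)).toAffine.Point` (the currency of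
X11b's `kummerOutside` index and of -w2 g11's point-index core p679632) and asked for the pinning in that currency. THIS FILE:
* §1 `exists_pointHom_localPointsMap` — GENERIC Galois descent: for `V/K` elliptic, a perfect `K`-field `E` and a `K`-isogeny `φ : V → V` there is
  an additive `f : V(E) → V(E)` with `ψ ∘ f = φ_E ∘ ψ` (`ψ : V(E) ↪ V(Ē)` the coordinate embedding `Affine.Point.map`, `φ_E = φ.localPointsMap E`);
  `pointHom_apply_apply_of_localPointsMap` — any such `f` inherits `f(f x) = f x − 2x` from `φ` (rigidity on `V(Ē)`, `Isogeny.apply_apply_add_smul_of_baseChange_field`).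
* §2 **`cmScalar_pointHom_of_frame`** — ON EVERY S3c FRAME, for ANY additive `f : E(K_v) → E(K_v)` with `ψ ∘ f = φ_{K_v} ∘ ψ` (`φ` the isogeny
  realising `π`): **for all `k` and ALL integers `N` with `N ≡ 1 − r (mod 2^k)`, every `Q ∈ E(K_v)` has `f Q − N·Q − 2^k·R` of finite order for
  some `R ∈ E(K_v)`** — the scalar of -w7 g3's `exists_scalar_adicCompletion_two` for `f` IS `1 − r` (dichotomy `scalar_dichotomy_two`; the branch
  `r` is excluded by file 1's `isOfFinAddOrder_of_cmScalar_eq_root`: the ℚ-generator would be torsion); `cmScalar_eq_one_sub_of_frame` — the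
  scalar `c` of ANY scalar statement for such an `f` equals `1 − r` (`scalar_unique_adicCompletion_two`).
USE ((PIN) of -w8 g3, (PI) discrepancy of -w2 g11): with `f` from §1 and `Q := (P_K)_v`: `π_v P − N·P ∈ 2^k E(K_v) + E(K_v)_tors` for every
`N ≡ 1 − r`; the Kummer-class reading («`H¹(ẽ_k)` of a local Kummer class is the class of a torsion point») is -w8 g3's bridge.
presearch: as file 1 ([corpus:silverman1994-advanced-topics II §1–§2], [corpus: Rubin1999 §3 Lemma 3.6 (ii)], [corpus: Agboola2007 §6 Prop. 6.11];
galaxy «formal group|split prime» → none) — no Literature fact filed. playbook: none fit.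

References: [Rubin1999] §3 Lemma 3.6 (ii), Cor. 3.17; [Agboola2007] §6 Prop. 6.11; [SilvermanAEC2009] Prop. VII.6.3, III.§4 (Thm. 4.8, Cor. 4.9),
VIII §1; [MilneADT2006] I §7 (proof of Thm. 7.3: the maps `f(K_v)`).
-/

noncomputable section

open scoped Classical

set_option linter.dupNamespace false
set_option autoImplicit false

open NumberField IsDedekindDomain Field WeierstrassCurve
open Literature.NumberTheory.EllipticCurves Literature.NumberTheory.EllipticCurves.GreenbergSelmer
open Literature.NumberTheory.EllipticCurves.Castella2018.AcSelmer
open Literature.NumberTheory.EllipticCurves.Agboola2007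
open Literature.NumberTheory.EllipticCurves.ResKernel
open Literature.NumberTheory.GaloisRepresentations

namespace Summit.BirchSwinnertonDyer.BirchSwinnertonDyer.Theorems.PrintCf2.CMPrimes

open Summit.BirchSwinnertonDyer.BirchSwinnertonDyer.Theorems.PrintCf2.RestrictedSelmerPair
open Summit.BirchSwinnertonDyer.BirchSwinnertonDyer.Theorems.PrintCf2.AdditiveAtSeven
open Summit.BirchSwinnertonDyer.BirchSwinnertonDyer.Theorems.PrintCf2.LocalTrichotomy
open Summit.BirchSwinnertonDyer.BirchSwinnertonDyer.Theorems.PrintCf2.LocalPointsScalar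

/-! ## §1. Galois descent of the local points map to `V(E)` -/

section Descent

variable {K : Type} [Field K] (V : WeierstrassCurve K) (E : Type) [Field E] [Algebra K E] [PerfectField E]

/-- **An isogeny over `K` acts on the `E`-rational points**, compatibly with its local points map: for a perfect `K`-field `E` and a
`K`-isogeny `φ : V → V` there is an additive `f : V(E) → V(E)` with `ψ (f Q) = φ_E (ψ Q)`, `ψ = Affine.Point.map (K → E → Ē)` the (injective)
coordinate map into `V(Ē) = localPoints V E`. Galois descent (`exists_map_eq_of_forall_smul_localPoints_eq`: `φ_E (ψ Q)` is `Γ_E`-fixed since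
`φ_E` is equivariant, `Isogeny.localPointsMap_smul`); additivity from the injectivity of `ψ`. Cf. the tree's `Isogeny.exists_pointHom_baseChange_eq`
(same statement for `Isogeny.baseChange` under an abstract `K̄`-algebra structure on `Ē`). [cite: SilvermanAEC2009, III.§4 with VIII.§1]
[cite: MilneADT2006, I §7 (proof of Thm. 7.3)] -/
theorem exists_pointHom_localPointsMap (φ : Isogeny V V) :
    ∃ f : (V.baseChange E).toAffine.Point →+ (V.baseChange E).toAffine.Point,
      ∀ Q, Affine.Point.map (W' := V) (IsScalarTower.toAlgHom K E (AlgebraicClosure E)) (f Q) =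
        φ.localPointsMap E (Affine.Point.map (W' := V) (IsScalarTower.toAlgHom K E (AlgebraicClosure E)) Q) := by
  set ψ : (V.baseChange E).toAffine.Point →+ localPoints V E :=
    Affine.Point.map (W' := V) (IsScalarTower.toAlgHom K E (AlgebraicClosure E)) with hψ
  have hψinj : Function.Injective ψ :=
    Affine.Point.map_injective (W' := V) (IsScalarTower.toAlgHom K E (AlgebraicClosure E))
  have hex : ∀ Y : (V.baseChange E).toAffine.Point, ∃ Z : (V.baseChange E).toAffine.Point,
      ψ Z = φ.localPointsMap E (ψ Y) := by
    intro Y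
    have hfix : ∀ σ : absoluteGaloisGroup E, σ • φ.localPointsMap E (ψ Y) = φ.localPointsMap E (ψ Y) := fun σ ↦ by
      rw [← φ.localPointsMap_smul, smul_map_baseChange_eq V E ψ hψ Y σ]
    obtain ⟨Z, hZ⟩ := exists_map_eq_of_forall_smul_localPoints_eq V E hfix
    exact ⟨Z, hZ⟩
  choose g hg using hex
  exact ⟨AddMonoidHom.mk' g (fun Y Z ↦ hψinj (by rw [hg, map_add, map_add, map_add, hg, hg])), fun Q ↦ hg Q⟩

omit [PerfectField E] in
/-- **The descended map inherits the quadratic relation**: if `φ(φP) = φP − 2P` on `V(K̄)` then `f(f x) = f x − 2x` on `V(E)` for every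
additive `f` with `ψ ∘ f = φ_E ∘ ψ` — the relation holds on ALL of `V(Ē)` by rigidity (`Isogeny.apply_apply_add_smul_of_baseChange_field`
for the `E`-isogeny `Isogeny.exists_baseChange_field`) and `ψ` is injective. [cite: SilvermanAEC2009, III.§4 Cor. 4.9] -/
theorem pointHom_apply_apply_of_localPointsMap [V.IsElliptic] (φ : Isogeny V V) (hφ : ∀ P, φ (φ P) = φ P - 2 • P)
    (f : (V.baseChange E).toAffine.Point →+ (V.baseChange E).toAffine.Point)
    (hf : ∀ Q, Affine.Point.map (W' := V) (IsScalarTower.toAlgHom K E (AlgebraicClosure E)) (f Q) =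
      φ.localPointsMap E (Affine.Point.map (W' := V) (IsScalarTower.toAlgHom K E (AlgebraicClosure E)) Q)) :
    ∀ x, f (f x) = f x - (2 : ℤ) • x := by
  set fE : localPoints V E →+ localPoints V E := φ.localPointsMap E with hfE
  set ψ : (V.baseChange E).toAffine.Point →+ localPoints V E :=
    Affine.Point.map (W' := V) (IsScalarTower.toAlgHom K E (AlgebraicClosure E)) with hψ
  have hψinj : Function.Injective ψ :=
    Affine.Point.map_injective (W' := V) (IsScalarTower.toAlgHom K E (AlgebraicClosure E))
  have hfA : ∀ Y, ψ (f Y) = fE (ψ Y) := fun Y ↦ hf Y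
  have hφ' : ∀ P : V.geomPoints, φ (φ P) + (-1 : ℤ) • φ P = (-2 : ℤ) • P := fun P ↦ by
    rw [hφ, neg_smul, one_smul, neg_smul, two_zsmul, two_nsmul]
    abel
  obtain ⟨φE, hφE, hφEq, -⟩ := Isogeny.exists_baseChange_field E φ
  have hrelE : ∀ q : localPoints V E, fE (fE q) = fE q - (2 : ℤ) • q := by
    intro q
    have h := Isogeny.apply_apply_add_smul_of_baseChange_field E φ hφ' φE hφE (localPointsEquivGeomPoints V E q)
    rw [hφEq (localPointsEquivGeomPoints V E q), AddEquiv.symm_apply_apply, hφEq, AddEquiv.symm_apply_apply] at h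
    have h2 : localPointsEquivGeomPoints V E (fE (fE q) + (-1 : ℤ) • fE q) =
        localPointsEquivGeomPoints V E ((-2 : ℤ) • q) := by
      rw [map_add, map_zsmul, map_zsmul]; exact h
    have h3 : fE (fE q) + (-1 : ℤ) • fE q = (-2 : ℤ) • q := (localPointsEquivGeomPoints V E).injective h2
    have h' : fE (fE q) = (-2 : ℤ) • q - (-1 : ℤ) • fE q := eq_sub_of_add_eq h3
    rw [h', neg_smul, neg_smul, one_smul, sub_neg_eq_add, neg_add_eq_sub]
  intro x
  exact hψinj (by rw [hfA, hfA, map_sub, map_zsmul, hfA, hrelE])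

end Descent

/-! ## §2. On the S3c frame the scalar of the descended map on `E(K_v)` is `1 − r`, for every `N ≡ 1 − r` -/

variable {K : Type} [Field K] [NumberField K]

/-- **THE CM SCALAR AT `v` IN POINT CURRENCY.** On an S3c frame (`C • W = cm7^{(d)}`, `d ≠ 0`; `K` imaginary quadratic, `2 = v·v̄`; `π² = π − 2`;
`r² = r − 2`; `P ∈ W(ℚ)` of infinite order; `Finite 𝔖_{v̄}(K, E[𝔮_r^∞])`), for the isogeny `φ` realising `π` and ANY additive
`f : E(K_v) → E(K_v)` (`E(K_v) = ((W.baseChange K).baseChange K_v).toAffine.Point`) with `ψ ∘ f = φ_{K_v} ∘ ψ`: for every `k`, every integer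
`N ≡ 1 − r (mod 2^k)` and every `Q ∈ E(K_v)` there is `R ∈ E(K_v)` with `f Q − N·Q − 2^k·R` of finite order — `π` acts on `E(K_v)/tors ≅ ℤ₂` as
`1 − r`. (The scalar `c` of `exists_scalar_adicCompletion_two` lies in `{r, 1 − r}` by `scalar_dichotomy_two`; `c = r` is excluded by
`isOfFinAddOrder_of_cmScalar_eq_root` of file 1 — (H1′) at `v` would then make `P_K` torsion.) [cite: Rubin1999, §3 Lemma 3.6 (ii), Cor. 3.17]
[cite: Agboola2007, §6 Prop. 6.11 (arXiv p0014)] [cite: SilvermanAEC2009, Prop. VII.6.3] -/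
theorem cmScalar_pointHom_of_frame {d : ℤ} (hd0 : d ≠ 0) (W : WeierstrassCurve ℚ) [W.IsElliptic]
    (C : VariableChange ℚ) (hCW : C • W = cm7.quadraticTwist (d : ℚ)) (hK : IsImaginaryQuadratic K)
    (v vbar : HeightOneSpectrum (𝓞 K)) (hv : ((2 : ℕ) : 𝓞 K) ∈ v.asIdeal) (hvbar : ((2 : ℕ) : 𝓞 K) ∈ vbar.asIdeal) (hne : vbar ≠ v)
    (π : (W.baseChange K).endRing) (hrel : (π : AddMonoid.End (W.baseChange K).geomPoints) * π = π - 2)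
    {r : ℤ_[2]} (hr : r * r = r - 2) (P : W.toAffine.Point) (hP : ¬ IsOfFinAddOrder P)
    (hfin : Finite (restrictedSelmerBase ↥((W.baseChange K).endEigenPrimaryTorsion 2 π r) 2 vbar))
    (φ : Isogeny (W.baseChange K) (W.baseChange K)) (hφ : ∀ Q, φ Q = (π : AddMonoid.End (W.baseChange K).geomPoints) Q)
    (f : ((W.baseChange K).baseChange (v.adicCompletion K)).toAffine.Point →+
      ((W.baseChange K).baseChange (v.adicCompletion K)).toAffine.Point)
    (hf : ∀ Q, Affine.Point.map (W' := W.baseChange K)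
        (IsScalarTower.toAlgHom K (v.adicCompletion K) (AlgebraicClosure (v.adicCompletion K))) (f Q) =
      φ.localPointsMap (v.adicCompletion K) (Affine.Point.map (W' := W.baseChange K)
        (IsScalarTower.toAlgHom K (v.adicCompletion K) (AlgebraicClosure (v.adicCompletion K))) Q)) :
    ∀ (k : ℕ) (N : ℤ), ((N : ℤ_[2]) - (1 - r)) ∈ (Ideal.span {(2 : ℤ_[2]) ^ k} : Ideal ℤ_[2]) →
      ∀ Q : ((W.baseChange K).baseChange (v.adicCompletion K)).toAffine.Point,
        ∃ R : ((W.baseChange K).baseChange (v.adicCompletion K)).toAffine.Point,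
          IsOfFinAddOrder (f Q - N • Q - ((2 : ℤ) ^ k) • R) := by
  haveI : Fact (Nat.Prime 2) := ⟨Nat.prime_two⟩
  set E := v.adicCompletion K with hE
  haveI : CharZero E := charZero_of_injective_algebraMap (algebraMap K E).injective
  haveI : ((W.baseChange K).baseChange E).IsElliptic := inferInstanceAs (((W.baseChange K).map (algebraMap K E)).IsElliptic)
  have hφ2 : ∀ Q, φ (φ Q) = φ Q - 2 • Q := fun Q ↦ by rw [hφ, hφ, cmEndo_apply_apply (W.baseChange K) hrel Q]
  have hf2 := pointHom_apply_apply_of_localPointsMap (W.baseChange K) E φ hφ2 f hf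
  obtain ⟨c, hc, hcA⟩ := scalar_dichotomy_two hK.1 hv hvbar hne ((W.baseChange K).baseChange E) f hf2 hr
  rcases hc with hc | hc
  · -- `c = r` is impossible: transport to the fixed points of `E(K̄_v)` and apply file 1
    exfalso
    subst hc
    set ψ : ((W.baseChange K).baseChange E).toAffine.Point →+ localPoints (W.baseChange K) E :=
      Affine.Point.map (W' := W.baseChange K) (IsScalarTower.toAlgHom K E (AlgebraicClosure E)) with hψ
    have hψfix : ∀ (Y : ((W.baseChange K).baseChange E).toAffine.Point) (σ : absoluteGaloisGroup E), σ • ψ Y = ψ Y :=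
      fun Y σ ↦ smul_map_baseChange_eq (W.baseChange K) E ψ hψ Y σ
    have hfA : ∀ Y, ψ (f Y) = φ.localPointsMap E (ψ Y) := fun Y ↦ hf Y
    have H : ∀ y : localPoints (W.baseChange K) E, (∀ σ : absoluteGaloisGroup E, σ • y = y) →
        ∀ n : ℕ, ∃ (y' : localPoints (W.baseChange K) E) (N₁ : ℤ) (m : ℤ),
          (∀ σ : absoluteGaloisGroup E, σ • y' = y') ∧ m ≠ 0 ∧
          ((N₁ : ℤ_[2]) - c) ∈ (Ideal.span {(2 : ℤ_[2]) ^ n} : Ideal ℤ_[2]) ∧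
          m • (φ.localPointsMap E y - N₁ • y - 2 ^ n • y') = 0 := by
      intro y hy n
      obtain ⟨Y, hY⟩ := exists_map_eq_of_forall_smul_localPoints_eq (W.baseChange K) E hy
      have hY' : ψ Y = y := hY
      obtain ⟨N₁, hN₁⟩ := exists_int_sub_mem_span (p := 2) c n
      obtain ⟨Y', hY''⟩ := hcA n N₁ hN₁ Y
      obtain ⟨m, hm0, hm⟩ := (isOfFinAddOrder_iff_nsmul_eq_zero).mp (ψ.isOfFinAddOrder hY'')
      refine ⟨ψ Y', N₁, (m : ℤ), fun σ ↦ hψfix Y' σ, by exact_mod_cast hm0.ne', hN₁, ?_⟩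
      have hψeq : ψ (f Y - N₁ • Y - ((2 : ℤ) ^ n) • Y') = φ.localPointsMap E y - N₁ • y - 2 ^ n • ψ Y' := by
        rw [map_sub, map_sub, hfA, map_zsmul, map_zsmul, hY', ← natCast_zsmul (ψ Y') (2 ^ n), Nat.cast_pow, Nat.cast_ofNat]
      rw [natCast_zsmul, ← hψeq]
      exact hm
    obtain ⟨hinf, hsup⟩ := endEigenPrimaryTorsion_compl_of_frame hd0 W C hCW K π hrel hr
    have hfin' := ConjTransport.finite_restrictedSelmerBase_conj_of_finite W K hK v vbar hv hvbar hne π hrel c hfin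
    have h1 := comap_kummer_le_ker_resOfLe_of_frame_of_cyclic hd0 W C hCW hK v π hrel hr P hP
      (kummer_local_cyclic_of_classical (W.baseChange K) 2 v (classical_local_cyclic hK hv hvbar hne (W.baseChange K))) hfin'
    exact not_isOfFinAddOrder_map_ofId W hP
      (isOfFinAddOrder_of_cmScalar_eq_root hK.1 hv hvbar hne (W.baseChange K) π hr hinf hsup φ hφ h1 H
        (Affine.Point.map (W' := W.toAffine) (Algebra.ofId ℚ K) P))
  · subst hc
    exact hcA

/-- **The scalar of the CM endomorphism on `E(K_v)` is `1 − r`** (uniqueness form): on an S3c frame, if `c ∈ ℤ₂` is ANY scalar of a descended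
`f` as above (`f Q − N·Q ∈ 2^k E(K_v) + tors` whenever `N ≡ c (mod 2^k)`), then `c = 1 − r` (`scalar_unique_adicCompletion_two` against
`cmScalar_pointHom_of_frame`). [cite: Rubin1999, §3 Lemma 3.6 (ii)] [cite: SilvermanAEC2009, Prop. VII.6.3] -/
theorem cmScalar_eq_one_sub_of_frame {d : ℤ} (hd0 : d ≠ 0) (W : WeierstrassCurve ℚ) [W.IsElliptic]
    (C : VariableChange ℚ) (hCW : C • W = cm7.quadraticTwist (d : ℚ)) (hK : IsImaginaryQuadratic K)
    (v vbar : HeightOneSpectrum (𝓞 K)) (hv : ((2 : ℕ) : 𝓞 K) ∈ v.asIdeal) (hvbar : ((2 : ℕ) : 𝓞 K) ∈ vbar.asIdeal) (hne : vbar ≠ v)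
    (π : (W.baseChange K).endRing) (hrel : (π : AddMonoid.End (W.baseChange K).geomPoints) * π = π - 2)
    {r : ℤ_[2]} (hr : r * r = r - 2) (P : W.toAffine.Point) (hP : ¬ IsOfFinAddOrder P)
    (hfin : Finite (restrictedSelmerBase ↥((W.baseChange K).endEigenPrimaryTorsion 2 π r) 2 vbar))
    (φ : Isogeny (W.baseChange K) (W.baseChange K)) (hφ : ∀ Q, φ Q = (π : AddMonoid.End (W.baseChange K).geomPoints) Q)
    (f : ((W.baseChange K).baseChange (v.adicCompletion K)).toAffine.Point →+
      ((W.baseChange K).baseChange (v.adicCompletion K)).toAffine.Point)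
    (hf : ∀ Q, Affine.Point.map (W' := W.baseChange K)
        (IsScalarTower.toAlgHom K (v.adicCompletion K) (AlgebraicClosure (v.adicCompletion K))) (f Q) =
      φ.localPointsMap (v.adicCompletion K) (Affine.Point.map (W' := W.baseChange K)
        (IsScalarTower.toAlgHom K (v.adicCompletion K) (AlgebraicClosure (v.adicCompletion K))) Q))
    {c : ℤ_[2]}
    (hc : ∀ (k : ℕ) (N : ℤ), ((N : ℤ_[2]) - c) ∈ (Ideal.span {(2 : ℤ_[2]) ^ k} : Ideal ℤ_[2]) →
      ∀ Q : ((W.baseChange K).baseChange (v.adicCompletion K)).toAffine.Point,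
        ∃ R : ((W.baseChange K).baseChange (v.adicCompletion K)).toAffine.Point,
          IsOfFinAddOrder (f Q - N • Q - ((2 : ℤ) ^ k) • R)) :
    c = 1 - r := by
  haveI : Fact (Nat.Prime 2) := ⟨Nat.prime_two⟩
  haveI : CharZero (v.adicCompletion K) := charZero_of_injective_algebraMap (algebraMap K (v.adicCompletion K)).injective
  haveI : ((W.baseChange K).baseChange (v.adicCompletion K)).IsElliptic :=
    inferInstanceAs (((W.baseChange K).map (algebraMap K (v.adicCompletion K))).IsElliptic)
  exact scalar_unique_adicCompletion_two hK.1 hv hvbar hne ((W.baseChange K).baseChange (v.adicCompletion K)) f hc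
    (cmScalar_pointHom_of_frame hd0 W C hCW hK v vbar hv hvbar hne π hrel hr P hP hfin φ hφ f hf)

end Summit.BirchSwinnertonDyer.BirchSwinnertonDyer.Theorems.PrintCf2.CMPrimes

end
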